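import Summits.QuantumFields.BalabanUV.T4Continuum.Support.SubstrateTransporterSpeciesLev
import Summits.QuantumFields.BalabanUV.T4Continuum.Support.SubstrateComplexBackground

/-!
# SUBSTRATE — [dict] D-8 (v) AT LEVEL LETTERS (S-LEV, typer RULING (η1) item 2): the level-lettered regular parameters `regularLev` of a
# complex background family (`ComplexBackgroundFamily`, p222080) and the level-lettered species `covAtTLev` along it — the centre OF RECORD
# regular AT EVERY LEVEL from J-3a BY NAME, and the ball form with no invertibility binder left at the printed letters

Cell `pub-balaban`, SUBSTRATE cell, seat `b2b-balaban-substrate-p1` (gen 3); statements = typer sketch v0.7 §LEV section `Family` (CREDIT: the FINDER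
lineage ne9-leaf-04 g16, kernel probe ADDENDUM A2 (A2-P4), adopted with the names of record), plus §3 (chart-coordinate families meet the EXPLICIT
ball `ρ⋆` of `SubstrateTransporterSpeciesLev`) and the record-centred ball form.  Summits-side under the LEAN PLACEMENT RULE.

HONEST FRAMING: rung (B)+1 of the FINITE-VOLUME T⁴ programme — NOT infinite volume, NOT a mass gap, NOT Clay; spine PROVED 0∕9; NE9 NOT proved.
BOOKKEEPING ∕ COMPOSITION BY NAME, 0 analysis; a complex background family is a DISPLAYED hypothesis structure — NOTHING here constructs one
([Balaban1987RG1] Lemma 4 p. 280 is the (H∃)-class T-row of NE9 that would; KIND only); the family's radius `ρ` is a datum, the ball `ρ′` of §2 is from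
openness (NOT computed) except along chart-coordinate families (§3), where `ρ⋆` is explicit.  COEXISTENCE: no declaration of p222080 is touched
(`regularLev_const` is `rfl`).  HONEST DEPENDENCY (cell line, verbatim): continuum YM on T⁴ ⇐ BetaPertH ∧ nine spine estimates (0/9 proved);
BetaPertH ⇐ (D1) ∧ (D4) ∧ CAP+tail; G-an2-4 gates asym, D1 and NE2/3/4.

WHAT.
* §1 `regularLev P cL aL Γ F := ⋂ k, F.regularAt (cL k) (aL k) Γ k`, `mem_regularLev_iff`, `regularLev_const` (= p222080 `regular`, `rfl`),
  `isOpen_ball_inter_regularLev`, `zero_mem_regularLev_iff`, `zero_mem_regularLev_of_isUnit`, **`zero_mem_regularLev_towerDataOf_of_regular`** (family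
  centred at `towerDataOf P ι av U`, unitary `ι`, regularity letters `α`, `τ` displayed per level, ONE margin `0 < gammaV`: the centre is regular AT
  EVERY LEVEL at the printed letters — J-3a `isUnit_det_deltaQOf_of_regular` BY NAME; the statement p222080's single-pair `h0` cannot receive for
  `K ≥ 1`).
* §2 `differentiableOn_covAtTLev_family` (on `ball 0 ρ ∩ regularLev`), `exists_ball_differentiableOn_covAtTLev_family` (openness),
  **`exists_ball_differentiableOn_covAtTLev_family_towerDataOf`** (printed letters, record-centred family: binders = the small-field letters only),
  `covAtTLev_family_zero`, `covAtOfRecord_eq_covAtTLev_family_zero`.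
* §3 chart-coordinate families `ofChart R0 ρ A …`: `regularAt_ofChart` ∕ `regularLev_ofChart` (= preimages of p221143's `regularSetAt` ∕ of
  `regularSetLev` under `A`, `rfl`), **`mem_regularLev_ofChart_of_norm_lt_rhoStar`** (`‖A ξ‖ < ρ⋆` ⇒ `ξ` regular at every level at the printed
  letters — the explicit ball transported to the family's parameters).
-/

noncomputable section

open scoped BigOperators ComplexConjugate Matrix Matrix.Norms.L2Operator Kronecker ComplexOrder

namespace Summit.QuantumFields.BalabanUV.T4Continuum.SubstrateComplexBackgroundLev

open Literature.MathematicalPhysics.QuantumFieldTheory.Balaban1983to89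
open Literature.MathematicalPhysics.QuantumFieldTheory.Balaban1983to89.B5Prop11Plancherel (Tor fine)
open Literature.MathematicalPhysics.QuantumFieldTheory.Balaban1983to89.B5G183RateUnitTower (lev lev_neZero)
open Summit.QuantumFields.BalabanUV.T4Continuum
open Summit.QuantumFields.BalabanUV.T4Continuum.CoerciveInverseTower (Coercive)
open Summit.QuantumFields.BalabanUV.T4Continuum.CovariantVectorCoercive (vecOp gammaV)
open Summit.QuantumFields.BalabanUV.T4Continuum.CovariantVectorGreenOfField (isUnit_det_deltaQOf_of_regular)
open Summit.QuantumFields.BalabanUV.T4Continuum.SubstrateCovariantAveraging (deltaQOf)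
open Summit.QuantumFields.BalabanUV.T4Continuum.SubstrateBackgroundTransporters (transV siteIdx unitMod transV_mem_unitaryGroup)
open Summit.QuantumFields.BalabanUV.T4Continuum.SubstrateTransporterSpecies
open Summit.QuantumFields.BalabanUV.T4Continuum.SubstrateTransporterSpeciesHolo
open Summit.QuantumFields.BalabanUV.T4Continuum.SubstrateTransporterSpeciesLev
open Summit.QuantumFields.BalabanUV.T4Continuum.SubstrateComplexBackground
open Summit.QuantumFields.BalabanUV.T4Continuum.CovariantBlockAveraging (ContourSystem transport)

variable (P : Params) {o : Type*} [Fintype o] [DecidableEq o]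
variable (cL : ℕ → ℂ) (aL : ℕ → ℝ) (Γ : (k : ℕ) → ContourSystem P.d (lev P.L k) (unitMod P))
variable {Ξ : Type*} [NormedAddCommGroup Ξ] [NormedSpace ℂ Ξ] {R0 : TowerData P o} {ρ : ℝ} (F : ComplexBackgroundFamily P Ξ R0 ρ)

/-! ## §1 The level-lettered regular parameters of a complex background family -/

/-- [folklore] **THE LEVEL-LETTERED REGULAR PARAMETERS**: p222080's `regularAt`, read at letters `(cL k, aL k)` at level `k`, intersected over
`k ≤ K`. -/
def regularLev : Set Ξ := ⋂ k : Fin (P.K + 1), ComplexBackgroundFamily.regularAt (cL k) (aL k) Γ F k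

/-- [folklore] Membership, unfolded. -/
theorem mem_regularLev_iff (ξ : Ξ) : ξ ∈ regularLev P cL aL Γ F ↔ ∀ k : Fin (P.K + 1), ξ ∈ ComplexBackgroundFamily.regularAt (cL k) (aL k) Γ F k :=
  Set.mem_iInter

/-- [folklore] COEXISTENCE: at constant letters `regularLev` IS p222080's `regular` (`rfl`). -/
theorem regularLev_const (c : ℂ) (a : ℝ) : regularLev P (fun _ => c) (fun _ => a) Γ F = ComplexBackgroundFamily.regular c a Γ F := rfl

/-- [folklore] The level-lettered regular parameters form an OPEN subset of the ball (p222080's `isOpen_ball_inter_regularAt`, level by level). -/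
theorem isOpen_ball_inter_regularLev : IsOpen (Metric.ball (0 : Ξ) ρ ∩ regularLev P cL aL Γ F) := by
  have h : Metric.ball (0 : Ξ) ρ ∩ regularLev P cL aL Γ F =
      ⋂ k : Fin (P.K + 1), (Metric.ball (0 : Ξ) ρ ∩ ComplexBackgroundFamily.regularAt (cL k) (aL k) Γ F k) := by
    ext ξ; simp only [regularLev, Set.mem_inter_iff, Set.mem_iInter]; exact ⟨fun h k => ⟨h.1, h.2 k⟩, fun h => ⟨(h 0).1, fun k => (h k).2⟩⟩
  rw [h]
  exact isOpen_iInter_of_finite fun k => ComplexBackgroundFamily.isOpen_ball_inter_regularAt (cL k) (aL k) Γ F k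

/-- [folklore] The centre is regular at every level iff the LEVEL-LETTERED invertibility display holds (p222080's `zero_mem_regularAt_iff`). -/
theorem zero_mem_regularLev_iff : (0 : Ξ) ∈ regularLev P cL aL Γ F ↔
    ∀ k : Fin (P.K + 1), IsUnit (deltaQT (lev P.L k) (unitMod P) (cL k) (aL k) (Γ k) (R0 k) (fun ν b => (R0 k ν b)⁻¹)).det := by
  simp only [mem_regularLev_iff, ComplexBackgroundFamily.zero_mem_regularAt_iff]

/-- [folklore] The centre is regular under the LEVEL-LETTERED invertibility display. -/
theorem zero_mem_regularLev_of_isUnit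
    (h : ∀ k : Fin (P.K + 1), IsUnit (deltaQT (lev P.L k) (unitMod P) (cL k) (aL k) (Γ k) (R0 k) (fun ν b => (R0 k ν b)⁻¹)).det) :
    (0 : Ξ) ∈ regularLev P cL aL Γ F :=
  (zero_mem_regularLev_iff P cL aL Γ F).2 h

section Record

variable {G : Type*} [GaugeGroup G] (ι : G →* Matrix o o ℂ) (av : ∀ j, Averaging P j G) {a' α τ : ℝ}

/-- [folklore] **AT THE PRINTED LETTERS THE CENTRE OF RECORD IS REGULAR AT EVERY LEVEL, BY NAME FROM J-3a** (family centred at the tower data of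
record `towerDataOf P ι av U`, unitary `ι` with `‖ι g − 1‖ = dist1 g`, regularity letters `α`, `τ` displayed per level, `0 < a′`, ONE margin
`0 < gammaV`) — the statement p222080's single-pair `h0` cannot receive from J-3a for `K ≥ 1`. -/
theorem zero_mem_regularLev_towerDataOf_of_regular (hι : ∀ g, ι g ∈ Matrix.unitaryGroup o ℂ) (hdist : ∀ g : G, ‖ι g - 1‖ = dist1 g)
    (U : GaugeField P 0 G) {ρ : ℝ} (F : ComplexBackgroundFamily P Ξ (towerDataOf P ι av U) ρ) (ha' : 0 < a') (hα : 0 ≤ α) (hτ : 0 ≤ τ)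
    (hU : ∀ (k : Fin (P.K + 1)) (b : PBond P (P.K - k)), ((lev P.L k : ℕ) : ℝ) * dist1 (Averaging.iter av (P.K - k) U b) ≤ α)
    (hT : ∀ (k : Fin (P.K + 1)) y jj μ (t : Fin (lev P.L k)),
      ‖transport (fine (lev P.L k) (unitMod P)) (towerDataOf P ι av U k) μ (Γ k y jj μ t) - 1‖ ≤ τ)
    (hγV : 0 < gammaV (Fintype.card o) P.d a' α τ) :
    (0 : Ξ) ∈ regularLev P (cPr P) (aPr P a') Γ F :=
  zero_mem_regularLev_of_isUnit P _ _ Γ F fun k => by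
    have hR : ∀ ν i, towerDataOf P ι av U k ν i ∈ Matrix.unitaryGroup o ℂ := fun ν i => transV_mem_unitaryGroup _ hι _ ν i
    rw [← adjOf_eq_inv hR, towerDataOf, ← deltaQOf_eq_deltaQT]
    exact isUnit_det_deltaQOf_of_regular P ι _ hdist ha' hα hτ (hU k) (hT k) hγV

end Record

/-! ## §2 The level-lettered species along the family -/

variable (s : ℕ → ℂ)

/-- [folklore] **`covAtTLev` ALONG THE FAMILY IS ℂ-DIFFERENTIABLE on the level-lettered regular part of the ball** (p222080's
`differentiableOn_unitCovT_family` at `(cL k, aL k)`). -/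
theorem differentiableOn_covAtTLev_family (k : ℕ) {T : Type*} (t : T) (b b' : (Tor (unitMod P) × Fin P.d) × o) :
    DifferentiableOn ℂ (fun ξ => covAtTLev P cL aL Γ s (F.uC ξ) (F.uCinv ξ) k t b b') (Metric.ball (0 : Ξ) ρ ∩ regularLev P cL aL Γ F) := by
  unfold covAtTLev covAtT
  by_cases hk : k ≤ P.K
  · simp only [dif_pos hk]
    exact (differentiableOn_matrix_iff.1
      (ComplexBackgroundFamily.differentiableOn_unitCovT_family (cL k) (aL k) Γ F ⟨k, Nat.lt_succ_of_le hk⟩ (s k)) b b').mono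
      (Set.inter_subset_inter_right _ (Set.iInter_subset _ _))
  · simp only [dif_neg hk]
    exact differentiableOn_const _

/-- [folklore] THE BALL FORM at level-lettered invertibility (openness; `ρ′` NOT computed — the family's own radius `ρ` is a datum): NE9's
`analyticClass` shape for the species-(a) slice curves, every level read at its own letters. -/
theorem exists_ball_differentiableOn_covAtTLev_family (hρ : 0 < ρ)
    (h0 : ∀ k : Fin (P.K + 1), IsUnit (deltaQT (lev P.L k) (unitMod P) (cL k) (aL k) (Γ k) (R0 k) (fun ν b => (R0 k ν b)⁻¹)).det) :
    ∃ ρ' > 0, ∀ (k : ℕ) {T : Type*} (t : T) (b b' : (Tor (unitMod P) × Fin P.d) × o),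
      DifferentiableOn ℂ (fun ξ => covAtTLev P cL aL Γ s (F.uC ξ) (F.uCinv ξ) k t b b') (Metric.ball (0 : Ξ) ρ') := by
  have hmem : (0 : Ξ) ∈ Metric.ball (0 : Ξ) ρ ∩ regularLev P cL aL Γ F := ⟨Metric.mem_ball_self hρ, zero_mem_regularLev_of_isUnit P cL aL Γ F h0⟩
  obtain ⟨ρ', hρ', hsub⟩ := Metric.isOpen_iff.1 (isOpen_ball_inter_regularLev P cL aL Γ F) 0 hmem
  exact ⟨ρ', hρ', fun k _ t b b' => (differentiableOn_covAtTLev_family P cL aL Γ F s k t b b').mono hsub⟩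

/-- [folklore] The centre of the family reads the two-sided level-lettered family at `(R0, R0⁻¹)`. -/
theorem covAtTLev_family_zero (k : ℕ) {T : Type*} (t : T) (b b' : (Tor (unitMod P) × Fin P.d) × o) :
    covAtTLev P cL aL Γ s (F.uC 0) (F.uCinv 0) k t b b' = covAtTLev P cL aL Γ s R0 (fun k ν b => (R0 k ν b)⁻¹) k t b b' := by
  rw [F.uC_zero, F.uCinv_zero]

section Record

variable {G : Type*} [GaugeGroup G] (ι : G →* Matrix o o ℂ) (av : ∀ j, Averaging P j G) {a' α τ : ℝ}

/-- [folklore] **THE CENTRE READS THE RECORD AT LEVEL LETTERS**: for a family centred at `towerDataOf P ι av U` (unitary `ι`) the covariance family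
OF RECORD at `U`, read at the level-`k` letters, is the family-read `covAtTLev` at `ξ = 0` (p222080 `covAtOfRecord_eq_covAtT_family_zero` at
`(cL k, aL k)`). -/
theorem covAtOfRecord_eq_covAtTLev_family_zero (hι : ∀ g, ι g ∈ Matrix.unitaryGroup o ℂ) (U : GaugeField P 0 G) {ρ : ℝ}
    (F : ComplexBackgroundFamily P Ξ (towerDataOf P ι av U) ρ) (k : ℕ) {T : Type*} (t : T) (b b' : (Tor (unitMod P) × Fin P.d) × o) :
    SubstrateRawSpecies.covAtOfRecord P ι av (cL k) (aL k) s Γ U k t b b' = covAtTLev P cL aL Γ s (F.uC 0) (F.uCinv 0) k t b b' :=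
  ComplexBackgroundFamily.covAtOfRecord_eq_covAtT_family_zero (cL k) (aL k) Γ s ι av hι U F k t b b'

/-- [folklore] **THE BALL FORM AT THE RECORD, PRINTED LETTERS — NO INVERTIBILITY BINDER LEFT**: for a family of radius `ρ > 0` centred at the
tower data of record of a levelwise-regular `U` (unitary `ι`, `‖ι g − 1‖ = dist1 g`, small-field letters `α`, `τ` at every level, `0 < a′`,
`0 < gammaV`) there is `ρ′ > 0` with every entry of `covAtTLev` along the family ℂ-differentiable on `ball 0 ρ′` (the centre's regularity from
J-3a BY NAME; `ρ′` from openness). -/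
theorem exists_ball_differentiableOn_covAtTLev_family_towerDataOf (hι : ∀ g, ι g ∈ Matrix.unitaryGroup o ℂ)
    (hdist : ∀ g : G, ‖ι g - 1‖ = dist1 g) (U : GaugeField P 0 G) {ρ : ℝ} (F : ComplexBackgroundFamily P Ξ (towerDataOf P ι av U) ρ)
    (hρ : 0 < ρ) (ha' : 0 < a') (hα : 0 ≤ α) (hτ : 0 ≤ τ)
    (hU : ∀ (k : Fin (P.K + 1)) (b : PBond P (P.K - k)), ((lev P.L k : ℕ) : ℝ) * dist1 (Averaging.iter av (P.K - k) U b) ≤ α)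
    (hT : ∀ (k : Fin (P.K + 1)) y jj μ (t : Fin (lev P.L k)),
      ‖transport (fine (lev P.L k) (unitMod P)) (towerDataOf P ι av U k) μ (Γ k y jj μ t) - 1‖ ≤ τ)
    (hγV : 0 < gammaV (Fintype.card o) P.d a' α τ) :
    ∃ ρ' > 0, ∀ (k : ℕ) {T : Type*} (t : T) (b b' : (Tor (unitMod P) × Fin P.d) × o),
      DifferentiableOn ℂ (fun ξ => covAtTLev P (cPr P) (aPr P a') Γ s (F.uC ξ) (F.uCinv ξ) k t b b') (Metric.ball (0 : Ξ) ρ') := by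
  have hmem : (0 : Ξ) ∈ Metric.ball (0 : Ξ) ρ ∩ regularLev P (cPr P) (aPr P a') Γ F :=
    ⟨Metric.mem_ball_self hρ, zero_mem_regularLev_towerDataOf_of_regular P Γ ι av hι hdist U F ha' hα hτ hU hT hγV⟩
  obtain ⟨ρ', hρ', hsub⟩ := Metric.isOpen_iff.1 (isOpen_ball_inter_regularLev P (cPr P) (aPr P a') Γ F) 0 hmem
  exact ⟨ρ', hρ', fun k _ t b b' => (differentiableOn_covAtTLev_family P (cPr P) (aPr P a') Γ F s k t b b').mono hsub⟩

end Record

/-! ## §3 Chart-coordinate families meet the explicit ball -/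

section Chart

variable (R0 ρ) (A : Ξ → TowerData P o) (hA0 : A 0 = 0)
  (hA : ∀ (k : Fin (P.K + 1)) ν b, DifferentiableOn ℂ (fun ξ => A ξ k ν b) (Metric.ball (0 : Ξ) ρ))

/-- [folklore] Along a chart-coordinate family `ofChart R0 ρ A …` the level-`k` regular parameters are the preimage under `A` of p221143's chart
regular set `regularSetAt … R0 k` (`rfl`). -/
theorem regularAt_ofChart (c : ℂ) (a : ℝ) (k : Fin (P.K + 1)) :
    ComplexBackgroundFamily.regularAt c a Γ (ComplexBackgroundFamily.ofChart R0 ρ A hA0 hA) k = A ⁻¹' regularSetAt P c a Γ R0 k := rfl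

/-- [folklore] … hence the level-lettered regular parameters are the preimage of `regularSetLev … R0`. -/
theorem regularLev_ofChart :
    regularLev P cL aL Γ (ComplexBackgroundFamily.ofChart R0 ρ A hA0 hA) = A ⁻¹' regularSetLev P cL aL Γ R0 := by
  ext ξ
  simp only [regularLev, regularSetLev, Set.mem_iInter, Set.mem_preimage]
  rfl

/-- [folklore] **THE EXPLICIT BALL ALONG A CHART-COORDINATE FAMILY**: at the printed letters, for a unitary, levelwise `γ_k`-coercive reference
tower `R0`, every parameter `ξ` whose chart coordinate satisfies `‖A ξ‖ < ρ⋆` (`rhoStar`, `SubstrateTransporterSpeciesLev`) is regular at every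
level — no openness, no existential. -/
theorem mem_regularLev_ofChart_of_norm_lt_rhoStar (hR0 : ∀ (k : Fin (P.K + 1)) ν i, R0 k ν i ∈ Matrix.unitaryGroup o ℂ) {a' : ℝ}
    {γ : Fin (P.K + 1) → ℝ} (hco : ∀ k : Fin (P.K + 1), Coercive (γ k) (vecOp (lev P.L k) (unitMod P) a' (Γ k) (R0 k))) (hγ : ∀ k, 0 < γ k)
    {ξ : Ξ} (hξ : ‖A ξ‖ < rhoStar P Γ hR0 hco hγ) :
    ξ ∈ regularLev P (cPr P) (aPr P a') Γ (ComplexBackgroundFamily.ofChart R0 ρ A hA0 hA) := by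
  rw [regularLev_ofChart]
  exact ball_rhoStar_subset_regularSetLev P Γ hR0 hco hγ (mem_ball_zero_iff.2 hξ)

end Chart

end Summit.QuantumFields.BalabanUV.T4Continuum.SubstrateComplexBackgroundLev

end
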